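import Literature.NumberTheory.Transcendental.KZLogCalculusProofs
import Summits.KontsevichZagierPeriods.KontsevichZagierPeriods.Theorems.HermiteRigidityGenusTwoCycleTransferPushforwardDimOne

/-!
# OffTetraSectorKernel (stmt-KontsevichZagierPeriods-10557), line odd-hyperbolic-ladder: stub stub_arcDistribution

The distribution relation of the arc carrier `C(z) = [(0,1), g_z]`,
`g_z(t) = Im z / ((1 − t Re z)² + (t Im z)²) = Im (z/(1 − t z))` (value `−arg (1 − z)`), over the
`k`-th roots `w₀, …, w_{k−1}` of `z`: `[C(z)] ≡ Σⱼ [C(wⱼ)]` modulo the moves of the Kontsevich–Zagier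
calculus, GIVEN the pointwise identity `Σⱼ g_{wⱼ}(t) = k t^{k−1} g_z(t^k)` (a hypothesis here; it is
the imaginary part of the logarithmic derivative of `∏ⱼ (1 − wⱼ t) = 1 − z t^k`).

Proof: two moves.
* Rule (2), the power substitution `t = τ^k` on `(0,1)`: the chart `Φ τ = τ^k` of `ℝ¹` is a
  `ℚ`-polynomial map, injective on `(0,1)` with image `(0,1)` (inverse `s ↦ s^{1/k}`), derivative
  `(k τ^{k−1}) • id` of absolute determinant `k τ^{k−1} > 0`; with SOURCE the representation
  `C' = [(0,1), Σⱼ (C wⱼ).integrand]` (an honest representation: finite sums of semialgebraic,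
  integrable functions) and IMAGE `C`, the pull-back identity
  `Σⱼ g_{wⱼ}(τ) = g_z(τ^k) · k τ^{k−1}` IS the hypothesis, so `[C'] − [C] ∈ changeOfVariablesRel`.
* Rule (1b), iterated integrand additivity (`KZ.of_sub_of_sub_sum_mem_relations`) with a zero
  representation `R₀` on `(0,1)`: `[C'] − [R₀] − Σⱼ [C(wⱼ)] ∈ relations` and `[R₀] ∈ relations`.
Bookkeeping in the free abelian group: `[C] − Σⱼ [C(wⱼ)] = ([C'] − [R₀] − Σⱼ …) − ([C'] − [C]) + [R₀]`.

No definitions are introduced (the chart, its derivative and the intermediate representation are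
written out inside the proofs), so that the file is a pure proof file; the derivative of a chart
`p ↦ (φ (p 0))` of `ℝ¹` and `det (c • id) = c` are the landed one-dimensional lemmas of
`HermiteRigidityGenusTwoCycleTransferPushforwardDimOne.lean`.

References: M. Kontsevich, D. Zagier, *Periods* (2001), §1.2, rules (1), (2).
-/

noncomputable section

open Set MeasureTheory
open Literature.NumberTheory.Transcendental
open Literature.ModelTheory.ExponentialFields (IsSemialgebraic)
open Summit.KontsevichZagierPeriods.HermiteRigidity.GenusTwoCycleTransfer (det_smul_id_fin_one
  hasFDerivAt_fin_one)

namespace Summit.KontsevichZagierPeriods.HyperbolicBloch.OffTetraSectorKernel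

/-! ### The power chart `Φ τ = τ^k` of `ℝ¹` -/

/-- The power chart `τ ↦ τ^k` (`k ≠ 0`) maps the open unit interval of `ℝ¹` ONTO itself
(preimage point `s^{1/k}`). [folklore] -/
theorem arcDistribution_image_pow {k : ℕ} (hk : k ≠ 0) :
    (fun x : Fin 1 → ℝ => fun _ : Fin 1 => x 0 ^ k) '' {t : Fin 1 → ℝ | 0 < t 0 ∧ t 0 < 1} =
      {t : Fin 1 → ℝ | 0 < t 0 ∧ t 0 < 1} := by
  ext y
  constructor
  · rintro ⟨x, ⟨hx0, hx1⟩, rfl⟩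
    exact ⟨pow_pos hx0 k, pow_lt_one₀ hx0.le hx1 hk⟩
  · rintro ⟨hy0, hy1⟩
    have hk' : (0 : ℝ) < (k : ℝ)⁻¹ := inv_pos.mpr (Nat.cast_pos.mpr (Nat.pos_of_ne_zero hk))
    refine ⟨fun _ => y 0 ^ ((k : ℝ)⁻¹),
      ⟨Real.rpow_pos_of_pos hy0 _, Real.rpow_lt_one hy0.le hy1 hk'⟩, ?_⟩
    funext i
    obtain rfl : i = 0 := Fin.fin_one_eq_zero i
    exact Real.rpow_inv_natCast_pow hy0.le hk

/-- The power chart `τ ↦ τ^k` (`k ≠ 0`) is injective on the open unit interval of `ℝ¹`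
(`τ ↦ τ^k` is injective on the nonnegative reals). [folklore] -/
theorem arcDistribution_injOn_pow {k : ℕ} (hk : k ≠ 0) :
    InjOn (fun x : Fin 1 → ℝ => fun _ : Fin 1 => x 0 ^ k) {t : Fin 1 → ℝ | 0 < t 0 ∧ t 0 < 1} := by
  intro x hx y hy h
  have h0 : x 0 ^ k = y 0 ^ k := congrFun h 0
  funext i
  obtain rfl : i = 0 := Fin.fin_one_eq_zero i
  exact (pow_left_inj₀ hx.1.le hy.1.le hk).mp h0

/-- The power chart `τ ↦ τ^k` of `ℝ¹` is a `ℚ`-semialgebraic map on every `ℚ`-semialgebraic set: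
its single component is the `ℚ`-polynomial `X₀^k`. [cite: BochnakCosteRoy1998, Prop. 2.2.6] -/
theorem arcDistribution_isSemialgebraicMapOn_pow {σ : Set (Fin 1 → ℝ)} (hσ : IsSemialgebraic ℚ σ)
    (k : ℕ) : IsSemialgebraicMapOn ℚ σ (fun x : Fin 1 → ℝ => fun _ : Fin 1 => x 0 ^ k) := by
  have h : IsSemialgebraicFunOn ℚ σ (fun x : Fin 1 → ℝ => x 0 ^ k) := by
    simpa using isSemialgebraicFunOn_aeval hσ ((MvPolynomial.X 0 : MvPolynomial (Fin 1) ℚ) ^ k)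
  exact IsSemialgebraicMapOn.of_forall hσ fun _ => h

/-! ### The stub -/

/-- STUB `stub_arcDistribution` (rules (2), (1b)): `[C(z)] ≡ Σⱼ [C(wⱼ)]` over the `k`-th roots `wⱼ` of `z`: ONE power
substitution `t = τ^k` on `(0,1)` (rule (2): `[(0,1), k τ^{k−1} g_z(τ^k)] ∼ [(0,1), g_z]`) and iterated integrand
additivity, GIVEN the pointwise identity (hypothesis; it is `stub_rootsPartialFractions`). The source of the
rule-(2) move is the honest representation `[(0,1), Σⱼ (C wⱼ).integrand]`, whose pull-back identity against `C`
is exactly the hypothesis; the algebraicity hypotheses on `z`, `wⱼ` are not used (all representations are given).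
[cite: KontsevichZagier2001, §1.2] -/
theorem stub_arcDistribution :
    ∀ (k : ℕ), 1 ≤ k → ∀ (z : ℂ) (w : Fin k → ℂ), IsAlgebraic ℚ z → (∀ j, IsAlgebraic ℚ (w j)) →
    (∀ t : ℝ, ∑ j, (w j).im / ((1 - t * (w j).re) ^ 2 + (t * (w j).im) ^ 2) =
      k * t ^ (k - 1) * (z.im / ((1 - t ^ k * z.re) ^ 2 + (t ^ k * z.im) ^ 2))) →
    ∀ (C : KZ.IntegralRep 1) (Cw : Fin k → KZ.IntegralRep 1),
      C.domain = {t | 0 < t 0 ∧ t 0 < 1} →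
      Set.EqOn C.integrand (fun t => z.im / ((1 - t 0 * z.re) ^ 2 + (t 0 * z.im) ^ 2)) C.domain →
      (∀ j, (Cw j).domain = {t | 0 < t 0 ∧ t 0 < 1}) →
      (∀ j, Set.EqOn (Cw j).integrand
        (fun t => (w j).im / ((1 - t 0 * (w j).re) ^ 2 + (t 0 * (w j).im) ^ 2)) (Cw j).domain) →
      KZ.of C - ∑ j, KZ.of (Cw j) ∈ KZ.relations := by
  intro k hk z w _ _ hid C Cw hCd hCi hCwd hCwi
  have hk0 : k ≠ 0 := Nat.one_le_iff_ne_zero.mp hk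
  have hCwd' : ∀ j, (Cw j).domain = C.domain := fun j => (hCwd j).trans hCd.symm
  -- the honest sum representation `[(0,1), Σⱼ (C wⱼ).integrand]`
  obtain ⟨C', hC'd, hC'i⟩ : ∃ C' : KZ.IntegralRep 1, C'.domain = C.domain ∧
      C'.integrand = fun x => ∑ j, (Cw j).integrand x :=
    ⟨{ domain := C.domain,
       integrand := fun x => ∑ j, (Cw j).integrand x,
       isSemialgebraic_domain := C.isSemialgebraic_domain,
       isSemialgebraicFunOn_integrand :=
         KZ.isSemialgebraicFunOn_finset_sum _ C.isSemialgebraic_domain fun j _ =>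
           hCwd' j ▸ (Cw j).isSemialgebraicFunOn_integrand,
       integrableOn := integrable_finsetSum _ fun j _ => hCwd' j ▸ (Cw j).integrableOn }, rfl, rfl⟩
  -- move (i): rule (2), the power substitution `t = τ^k` on `(0,1)`, source `C'`, image `C`
  have hcov : KZ.of C' - KZ.of C ∈ KZ.relations := by
    refine KZ.changeOfVariablesRel_subset_relations
      ⟨1, C', C, fun x : Fin 1 → ℝ => fun _ : Fin 1 => x 0 ^ k,
        fun x => ((k : ℝ) * x 0 ^ (k - 1)) • ContinuousLinearMap.id ℝ (Fin 1 → ℝ),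
        hC'd ▸ arcDistribution_isSemialgebraicMapOn_pow C.isSemialgebraic_domain k,
        fun x _ =>
          (hasFDerivAt_fin_one (fun s : ℝ => s ^ k) _ x (hasDerivAt_pow k (x 0))).hasFDerivWithinAt,
        ?_, ?_,
        fun x hx => ?_, rfl⟩
    · rw [hC'd, hCd]
      exact arcDistribution_injOn_pow hk0
    · rw [hC'd, hCd, arcDistribution_image_pow hk0]
    · -- the pull-back identity on `(0,1)`, Jacobian `|k τ^{k−1}| = k τ^{k−1}` included
      have hx' : 0 < x 0 ∧ x 0 < 1 := by
        rw [hC'd, hCd] at hx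
        exact hx
      have hΦx : (fun _ : Fin 1 => x 0 ^ k) ∈ C.domain := by
        rw [hCd]
        exact ⟨pow_pos hx'.1 k, pow_lt_one₀ hx'.1.le hx'.2 hk0⟩
      have hkpos : (0 : ℝ) < k := Nat.cast_pos.mpr (Nat.pos_of_ne_zero hk0)
      have hpos : 0 < (k : ℝ) * x 0 ^ (k - 1) := mul_pos hkpos (pow_pos hx'.1 _)
      have hs : ∑ j, (Cw j).integrand x =
          ∑ j, (w j).im / ((1 - x 0 * (w j).re) ^ 2 + (x 0 * (w j).im) ^ 2) :=
        Finset.sum_congr rfl fun j _ => hCwi j (by rw [hCwd' j, ← hC'd]; exact hx)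
      rw [det_smul_id_fin_one, abs_of_pos hpos, hCi hΦx, hC'i]
      beta_reduce
      rw [hs, hid (x 0)]
      ring
  -- move (ii): rule (1b), iterated integrand additivity with a zero representation `R₀`
  obtain ⟨R₀, hR₀d, hR₀i⟩ := KZ.exists_zeroRep C.isSemialgebraic_domain
  have hsum : KZ.of C' - KZ.of R₀ - ∑ j, KZ.of (Cw j) ∈ KZ.relations :=
    KZ.of_sub_of_sub_sum_mem_relations k C' R₀ Cw (hR₀d.trans hC'd.symm)
      (fun j => (hCwd' j).trans hC'd.symm) fun x _ => by
        rw [hC'i, hR₀i]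
        simp
  have hR₀ : KZ.of R₀ ∈ KZ.relations :=
    KZ.of_mem_relations_of_eqOn_zero R₀ (by rw [hR₀i]; exact fun _ _ => rfl)
  have : KZ.of C - ∑ j, KZ.of (Cw j) =
      (KZ.of C' - KZ.of R₀ - ∑ j, KZ.of (Cw j)) - (KZ.of C' - KZ.of C) + KZ.of R₀ := by abel
  rw [this]
  exact KZ.relations.add_mem (KZ.relations.sub_mem hsum hcov) hR₀

end Summit.KontsevichZagierPeriods.HyperbolicBloch.OffTetraSectorKernel
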